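import Literature.NumberTheory.Automorphic.NewformAdelisationArchSmooth
import Literature.NumberTheory.Automorphic.NewformAdelisationCasimir
import HarnessLib

/-!
# Stub `stub_loweringKillsLift` of line adelic-newform-datum-double-twist
# (crux stmt-Langlands-12944 `PhantomRMYoshida.SerreKWAutomorphicGL2`)

Lever (B), analytic input of the automorphic half of the line: for every cusp form
`f ∈ S_w(Γ₁(N))` (any weight, no eigen-assumption) and every compactness witness `hcpt` of the
`GL₂/ℚ` automorphy datum, the adelic lift `φ_f = adelicLiftFunA N w f : GL₂(𝔸_ℚ) → ℂ`
(Gelbart 1975, (3.4)) is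

* smooth in the archimedean variable of the Borel–Jacquet datum `AutomorphyDatum.gl 2 ℚ hcpt`
  (`IsArchSmooth`; Gelbart 1975, Prop. 3.1 (iv); Borel–Jacquet 1979, 4.2 (b)) — the Literature
  brick `isArchSmooth_ofArch_adelicLiftFunA_cuspForm` (`NewformAdelisationArchSmooth`: the exact
  archimedean slices `φ_f(a ι_𝔸(x)) = archLift w f (h₀ x)` are real-smooth functions of the matrix
  entries because `f` is holomorphic, and smoothness along `ι_𝔸 : GL₂(ℝ) → GL₂(𝔸_ℚ)` is smoothness
  for the datum since `ℝ ≃ ℚ_∞`), and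
* killed by the lowering operator `X = h - i(E₁₂ + E₂₁)` along `ι_𝔸`
  (`GL2Real.lowerFun Rat.iotaA φ_f = 0`; Gelbart 1975, Prop. 3.1 (v); Gelbart 1997, (2.5.4) (v):
  the Cauchy–Riemann equations of `f` read in the group) — the Literature theorem
  `lowerFun_adelicLiftFunA_eq_zero` (`NewformAdelisationCasimir`), whose smoothness hypothesis is
  the first conjunct.

## References

* S. Gelbart, *Automorphic forms on adele groups*, Ann. of Math. Stud. 83 (1975), §3.A, (3.4),
  Prop. 3.1 (iv)–(v). [Gelbart1975]
* S. Gelbart, *Three lectures on the modularity of `ρ̄_{E,3}` …* (1997), (2.5.4) (v). [Gelbart1997]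
* D. Bump, *Automorphic Forms and Representations* (1997), §2.1, §3.2 (2.13), §3.6. [Bump1997]
-/

open scoped MatrixGroups Classical
open NumberField CongruenceSubgroup Literature.NumberTheory.Automorphic

namespace Summit.Langlands.Langlands.Cruxes.SerreKWAutomorphicGL2.AdelicNewformDatumDoubleTwist

set_option linter.dupNamespace false

/-- **Stub 4 of the line (lowering kills the lift; smoothness in the archimedean variable).**
For every cusp form `f ∈ S_w(Γ₁(N))` and every compactness witness `hcpt`, the adelic lift
`φ_f = adelicLiftFunA N w f` on `GL₂(𝔸_ℚ)` is smooth in the archimedean variable of the automorphy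
datum `AutomorphyDatum.gl 2 ℚ hcpt` and is annihilated by the lowering operator
`X = h - i(E₁₂ + E₂₁)` along `ι_𝔸 : GL₂(ℝ) → GL₂(𝔸_ℚ)`. Proof: the smoothness is
`isArchSmooth_ofArch_adelicLiftFunA_cuspForm` (holomorphy of `f` on the exact archimedean slices,
transported from `ι_𝔸` to the datum along `ℝ ≃ ℚ_∞`), and then `X φ_f = 0` is
`lowerFun_adelicLiftFunA_eq_zero` (Cauchy–Riemann through
`GL2Real.mdifferentiableAt_archDescent_iff_lowering` at the section points, weight `w - 2` of
`X φ_f` elsewhere). Gelbart 1975, Prop. 3.1 (iv)–(v); Bump 1997, p. 274, (2.13).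
[cite: Gelbart1975, Prop. 3.1 (iv)–(v), p. 28] [cite: Bump1997, §3.2 (2.13) p. 274] -/
theorem stub_loweringKillsLift :
    ∀ (N : ℕ) [NeZero N] (w : ℤ) (f : CuspForm (Gamma1 N) w)
      (hcpt : isCompact_glFiniteIntegralLevel 2 ℚ),
      IsArchSmooth (AutomorphyDatum.gl 2 ℚ hcpt).ofArch (adelicLiftFunA N w ⇑f) ∧
        GL2Real.lowerFun Rat.iotaA (adelicLiftFunA N w ⇑f) = 0 := by
  intro N _ w f hcpt
  have hA : IsArchSmooth (AutomorphyDatum.gl 2 ℚ hcpt).ofArch (adelicLiftFunA N w ⇑f) :=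
    isArchSmooth_ofArch_adelicLiftFunA_cuspForm f
  exact ⟨hA, lowerFun_adelicLiftFunA_eq_zero f hA⟩

end Summit.Langlands.Langlands.Cruxes.SerreKWAutomorphicGL2.AdelicNewformDatumDoubleTwist
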